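import Summits.QuantumAdvantage.QuantumAdvantage.Theorems.SosSandwichPseudoBoundedAAClassicalCornerBlockProduct
import Summits.QuantumAdvantage.QuantumAdvantage.Theorems.SosSandwichPseudoBoundedAAClassicalCornerSensitivityOSSSCompare
import HarnessLib

/-!
# Crux `PseudoBoundedAA` (stmt-QuantumAdvantage-15237, route SosSandwich) — the `L²`-OSSS law with constant ONE on the
# block-product corner: `16·Var[p]² ≤ Σⱼ δ̄ⱼ·Infⱼ[p]` for mixtures of trees on pairwise disjoint blocks

Support file (`--supports stmt-QuantumAdvantage-15237`).  `…ClassicalCornerBlockProduct.lean` proved the depth form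
`16·Var² ≤ T·maxInf` on the BLOCK-PRODUCT corner (mixtures `p = Σ_k w_k [t_k accepts]`, `Σ w ≤ 1`, the tree `t_k` reading
only a block `S_k`, blocks pairwise disjoint); `…ClassicalCornerNonadaptiveOSSS.lean` proved the `δ̄`-form with constant
`1` on the NONADAPTIVE corner.  This file closes census item (3) of the hands' list: the `δ̄`-form with constant `1` on the
block-product corner,

  `16 · Var[p]² ≤ Σⱼ δ̄ⱼ · Infⱼ[p]`,  `δ̄ⱼ = Σ_k w_k·#{x : j ∈ t_k.queries x}/2^N`
  (`sixteen_variance_sq_le_sum_queryProb_influence_of_blockDisjoint`),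

i.e. the conjectured `L²`-OSSS law holds with the sharp constant `C₀ = 1` as soon as the components do not share
variables (adaptive inside each block).  Proof: independence of disjoint blocks (`Var = Σ w_k² V_k`,
`ClassicalCornerBlockProduct.two_pow_mul_sum_mul_eq_sum_mul_sum`), `Infⱼ[p] = w_k² Infⱼ[F_k]` on `S_k`, OSSS with query
probabilities for each tree (`ClassicalCornerQueryOSSS.osss_queries`: `4V_k ≤ Σⱼ δⱼ(t_k) Infⱼ[F_k]`), and the
sub-probability Cauchy–Schwarz `(Σ w_k² V_k)² ≤ Σ w_k³ V_k²` (`sq_sum_mul_le_sum_mul_sq`) with `V_k ≤ ¼`: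
`16Var² ≤ 16 Σ w_k³ V_k² ≤ 4 Σ w_k³ V_k ≤ Σ_k w_k³ Σⱼ δⱼ(t_k) Infⱼ[F_k] = Σⱼ δ̄ⱼ Infⱼ[p]` (for `j ∈ S_k` only tree `k`
contributes to `δ̄ⱼ·Infⱼ[p] ≥ w_k δⱼ(t_k)·w_k² Infⱼ[F_k]`).  Together with the general law `16Var² ≤ Ī·Σⱼ δ̄ⱼ Infⱼ`
(`…SensitivityOSSS.lean`) this brackets the open absolute constant between the corners where it is `1` and the adaptive
overlapping mixtures where the numerics give `8/7 … ≈ 1.16`.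

Honest label: calibration of a sub-corner of an open conjecture; no registered stub, crux or summit is closed.
Sources: R. O'Donnell, M. Saks, O. Schramm, R. Servedio, FOCS 2005, Thm 3.2; R. O'Donnell, *Analysis of Boolean
Functions* (2014) §8.6; S. Aaronson, A. Ambainis, arXiv:0911.0996, Thm 8 and the remark following it.
-/

set_option linter.dupNamespace false

noncomputable section

namespace Summit.QuantumAdvantage.QuantumAdvantage.Theorems.SosSandwich

open Finset Function
open Literature.Computability.Complexity Literature.Computability.QuantumComplexity

namespace ClassicalCornerBlockProduct

variable {N : ℕ}

/-- **`L²`-OSSS with constant one on the block-product corner.** If `p = Σ_{k∈s} w_k·[t_k accepts]` on the cube with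
`w_k ≥ 0`, `Σ w_k ≤ 1`, each tree `t_k` depending only on the coordinates of a block `S_k`, the blocks pairwise disjoint,
then `16·Var[p]² ≤ Σⱼ δ̄ⱼ·Infⱼ[p]` with the mixture's query probabilities `δ̄ⱼ = Σ_k w_k·#{x : j ∈ t_k.queries x}/2^N` —
no depth factor, constant `1` (sharp at `T = 1`).
[cite: OdonnellEtAl2005, Thm 3.2] [cite: ODonnell2014, §8.6] [cite: AaronsonAmbainis2014, Thm 8 and the remark following it] -/
theorem sixteen_variance_sq_le_sum_queryProb_influence_of_blockDisjoint {ι : Type*} (s : Finset ι) (w : ι → ℝ)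
    (hw : ∀ k ∈ s, 0 ≤ w k) (hw1 : ∑ k ∈ s, w k ≤ 1)
    (S : ι → Finset (Fin N)) (hdisj : ∀ k ∈ s, ∀ l ∈ s, k ≠ l → Disjoint (S k) (S l))
    (t : ι → DecisionTree N)
    (ht : ∀ k ∈ s, ∀ x y : Fin N → Bool, (∀ i ∈ S k, x i = y i) → (t k).eval x = (t k).eval y)
    (p : MvPolynomial (Fin N) ℝ)
    (hp : ∀ x, evalBool p x = ∑ k ∈ s, w k * (if (t k).eval x = true then (1 : ℝ) else 0)) :
    16 * boolVariance p ^ 2 ≤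
      ∑ j, (∑ k ∈ s, w k *
          (((Finset.univ.filter fun x : Fin N → Bool => j ∈ (t k).queries x).card : ℝ) / (2 : ℝ) ^ N)) *
        influence j p := by
  classical
  -- notation
  set E : ℝ := (2 : ℝ) ^ N with hE
  have hEpos : 0 < E := by positivity
  set F : ι → (Fin N → Bool) → ℝ := fun k x => if (t k).eval x = true then (1 : ℝ) else 0 with hFdef
  have hF01 : ∀ k x, F k x = 0 ∨ F k x = 1 := by
    intro k x
    simp only [hFdef]
    split_ifs <;> simp
  have hFsq : ∀ k x, F k x * F k x = F k x := by
    intro k x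
    rcases hF01 k x with h | h <;> simp [h]
  have hFdep : ∀ k ∈ s, ∀ x y : Fin N → Bool, (∀ i ∈ S k, x i = y i) → F k x = F k y := by
    intro k hk x y hxy
    simp only [hFdef, ht k hk x y hxy]
  set A : ι → ℝ := fun k => ∑ x, F k x with hAdef
  set V : ι → ℝ := fun k => E * (∑ x, F k x * F k x) - A k * A k with hVdef
  set I : ι → Fin N → ℝ := fun k j => ∑ x, |F k (update x j true) - F k (update x j false)| with hIdef
  set q : ι → Fin N → ℝ := fun k j =>
    ((Finset.univ.filter fun x : Fin N → Bool => j ∈ (t k).queries x).card : ℝ) with hqdef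
  have hA0 : ∀ k, 0 ≤ A k := fun k =>
    Finset.sum_nonneg fun x _ => by rcases hF01 k x with h | h <;> simp [h]
  have hAE : ∀ k, A k ≤ E := by
    intro k
    calc A k = ∑ x, F k x := rfl
      _ ≤ ∑ _x : Fin N → Bool, (1 : ℝ) :=
          Finset.sum_le_sum fun x _ => by rcases hF01 k x with h | h <;> simp [h]
      _ = E := by
          rw [Finset.sum_const, Finset.card_univ, BooleanCorner.card_cube_nat, nsmul_eq_mul, mul_one]
          push_cast
          rfl
  have hVeq : ∀ k, V k = A k * (E - A k) := by
    intro k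
    simp only [hVdef, hAdef]
    rw [Finset.sum_congr rfl fun x _ => hFsq k x]
    ring
  have hV0 : ∀ k, 0 ≤ V k := fun k => by
    rw [hVeq]
    exact mul_nonneg (hA0 k) (sub_nonneg.2 (hAE k))
  have hVle : ∀ k, V k ≤ E ^ 2 / 4 := by
    intro k
    rw [hVeq]
    nlinarith [hA0 k, hAE k, sq_nonneg (E - 2 * A k)]
  have hI0 : ∀ k j, 0 ≤ I k j := fun k j => Finset.sum_nonneg fun x _ => abs_nonneg _
  have hq0 : ∀ k j, 0 ≤ q k j := fun k j => by positivity
  -- (1) independence of disjoint blocks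
  have hcross : ∀ k ∈ s, ∀ l ∈ s, k ≠ l → E * ∑ x, F k x * F l x = A k * A l := by
    intro k hk l hl hkl
    refine two_pow_mul_sum_mul_eq_sum_mul_sum (S k) (F k) (F l) (hFdep k hk) ?_
    intro x y hxy
    refine hFdep l hl x y fun i hi => hxy i fun hik => ?_
    exact Finset.disjoint_left.1 (hdisj k hk l hl hkl) hik hi
  -- (2) the variance identity `E · (E · Var[p]) = Σ_k w_k² V_k`
  have hvar : E * (E * boolVariance p) = ∑ k ∈ s, w k ^ 2 * V k := by
    rw [← BooleanCorner.sum_sq_sub_sq_sum_eq p]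
    have hsq : ∑ x, evalBool p x * evalBool p x
        = ∑ k ∈ s, ∑ l ∈ s, w k * w l * ∑ x, F k x * F l x := by
      calc ∑ x, evalBool p x * evalBool p x
          = ∑ x, ∑ k ∈ s, ∑ l ∈ s, w k * w l * (F k x * F l x) := by
            refine Finset.sum_congr rfl fun x _ => ?_
            rw [hp x, Finset.sum_mul_sum]
            exact Finset.sum_congr rfl fun k _ => Finset.sum_congr rfl fun l _ => by ring
        _ = ∑ k ∈ s, ∑ x, ∑ l ∈ s, w k * w l * (F k x * F l x) := Finset.sum_comm
        _ = ∑ k ∈ s, ∑ l ∈ s, ∑ x, w k * w l * (F k x * F l x) :=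
            Finset.sum_congr rfl fun k _ => Finset.sum_comm
        _ = ∑ k ∈ s, ∑ l ∈ s, w k * w l * ∑ x, F k x * F l x :=
            Finset.sum_congr rfl fun k _ => Finset.sum_congr rfl fun l _ => by rw [Finset.mul_sum]
    have hlin : ∑ x, evalBool p x = ∑ k ∈ s, w k * A k := by
      calc ∑ x, evalBool p x = ∑ x, ∑ k ∈ s, w k * F k x := Finset.sum_congr rfl fun x _ => hp x
        _ = ∑ k ∈ s, ∑ x, w k * F k x := Finset.sum_comm
        _ = ∑ k ∈ s, w k * A k := Finset.sum_congr rfl fun k _ => by rw [Finset.mul_sum]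
    rw [hsq, hlin, Finset.sum_mul_sum, Finset.mul_sum, ← Finset.sum_sub_distrib]
    refine Finset.sum_congr rfl fun k hk => ?_
    rw [Finset.mul_sum, ← Finset.sum_sub_distrib]
    rw [Finset.sum_eq_single_of_mem k hk]
    · simp only [hVdef]
      ring
    · intro l hl hlk
      have hc := hcross k hk l hl (Ne.symm hlk)
      calc E * (w k * w l * ∑ x, F k x * F l x) - w k * A k * (w l * A l)
          = w k * w l * (E * ∑ x, F k x * F l x - A k * A l) := by ring
        _ = 0 := by rw [hc, sub_self, mul_zero]
  -- (3) OSSS with query probabilities for each tree: `V_k ≤ (Σ_j q_kj I_kj)/4`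
  have hosss : ∀ k, V k ≤ (∑ j, q k j * I k j) / 4 := fun k =>
    ClassicalCornerQueryOSSS.osss_queries (t k) (F k) (F k) (I k) (fun x => rfl) (hI0 k) (fun j => le_rfl)
  -- (4) `I_kj = 0` off the block; `E · Inf_j[p] = w_k² I_kj` on the block `S_k`
  have hIoff : ∀ k ∈ s, ∀ j, j ∉ S k → I k j = 0 := by
    intro k hk j hj
    refine Finset.sum_eq_zero fun x _ => ?_
    rw [hFdep k hk (update x j true) (update x j false) fun i hi => ?_, sub_self, abs_zero]
    have hij : i ≠ j := fun h => hj (h ▸ hi)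
    rw [update_of_ne hij, update_of_ne hij]
  have hinf : ∀ k ∈ s, ∀ j ∈ S k, E * influence j p = w k ^ 2 * I k j := by
    intro k hk j hj
    rw [← BooleanCorner.sum_sq_update_eq_influence p j]
    have hpt : ∀ x : Fin N → Bool, evalBool p (update x j true) - evalBool p (update x j false)
        = w k * (F k (update x j true) - F k (update x j false)) := by
      intro x
      rw [hp, hp, ← Finset.sum_sub_distrib]
      rw [Finset.sum_eq_single_of_mem k hk]
      · ring
      · intro l hl hlk
        have hjl : j ∉ S l := fun h =>
          Finset.disjoint_left.1 (hdisj k hk l hl (Ne.symm hlk)) hj h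
        show w l * F l (update x j true) - w l * F l (update x j false) = 0
        rw [hFdep l hl (update x j true) (update x j false) fun i hi => ?_, sub_self]
        have hij : i ≠ j := fun h => hjl (h ▸ hi)
        rw [update_of_ne hij, update_of_ne hij]
    have habs : ∀ x : Fin N → Bool, (F k (update x j true) - F k (update x j false)) ^ 2
        = |F k (update x j true) - F k (update x j false)| := by
      intro x
      rcases hF01 k (update x j true) with h | h <;>
        rcases hF01 k (update x j false) with h' | h' <;> simp [h, h']
    simp only [hIdef]
    rw [Finset.mul_sum]
    refine Finset.sum_congr rfl fun x _ => ?_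
    rw [hpt x, mul_pow, habs x]
  -- (5) lower bound of the right-hand side by the block terms
  set δb : Fin N → ℝ := fun j => ∑ k ∈ s, w k * (q k j / E) with hδb
  have hδb0 : ∀ j, 0 ≤ δb j := fun j => Finset.sum_nonneg fun k hk => mul_nonneg (hw k hk) (by positivity)
  have hRHS : ∑ k ∈ s, w k ^ 3 * (∑ j, q k j * I k j) ≤ E * (E * ∑ j, δb j * influence j p) := by
    -- per block: `w_k³ Σ_j q_kj I_kj = Σ_{j ∈ S_k} w_k q_kj · (w_k² I_kj) ≤ E² Σ_{j∈S_k} δb_j Inf_j`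
    have hk : ∀ k ∈ s, w k ^ 3 * (∑ j, q k j * I k j) ≤ E * (E * ∑ j ∈ S k, δb j * influence j p) := by
      intro k hk
      have hIsum : ∑ j, q k j * I k j = ∑ j ∈ S k, q k j * I k j := by
        rw [← Finset.sum_subset (Finset.subset_univ (S k))]
        intro j _ hj
        rw [hIoff k hk j hj, mul_zero]
      rw [hIsum, Finset.mul_sum, Finset.mul_sum, Finset.mul_sum]
      refine Finset.sum_le_sum fun j hj => ?_
      have hδ : w k * (q k j / E) ≤ δb j := by
        rw [hδb]
        exact Finset.single_le_sum (f := fun l => w l * (q l j / E))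
          (fun l hl => mul_nonneg (hw l hl) (by positivity)) hk
      have hIj := hinf k hk j hj
      have hwk := hw k hk
      -- `w³ q I = E² · (w q/E) · (w² I/E)` and `w² I / E = Inf_j`
      have e1 : w k ^ 3 * (q k j * I k j) = E * (E * ((w k * (q k j / E)) * influence j p)) := by
        have : influence j p = w k ^ 2 * I k j / E := by
          rw [← hIj]; field_simp
        rw [this]; field_simp
      rw [e1]
      have hI' := influence_nonneg j p
      gcongr
    calc ∑ k ∈ s, w k ^ 3 * (∑ j, q k j * I k j)
        ≤ ∑ k ∈ s, E * (E * ∑ j ∈ S k, δb j * influence j p) := Finset.sum_le_sum hk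
      _ = E * (E * ∑ k ∈ s, ∑ j ∈ S k, δb j * influence j p) := by
          rw [Finset.mul_sum, Finset.mul_sum]
      _ ≤ E * (E * ∑ j, δb j * influence j p) := by
          have hsub : ∑ k ∈ s, ∑ j ∈ S k, δb j * influence j p ≤ ∑ j, δb j * influence j p := by
            rw [← Finset.sum_biUnion hdisj]
            exact Finset.sum_le_sum_of_subset_of_nonneg (Finset.subset_univ _)
              fun j _ _ => mul_nonneg (hδb0 j) (influence_nonneg j p)
          gcongr
  -- (6) assemble: `16 E⁴ Var² = 16 (Σ w² V)² ≤ 16 Σ w³ V² ≤ 4 E² Σ w³ V ≤ E² Σ w³ Σ_j q I ≤ E⁴ Σ_j δb_j Inf_j`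
  have hCS : (∑ k ∈ s, w k ^ 2 * V k) ^ 2 ≤ ∑ k ∈ s, w k ^ 3 * V k ^ 2 := by
    have := ClassicalCornerSensitivityOSSS.sq_sum_mul_le_sum_mul_sq s w (fun k => w k * V k) hw hw1
    have e1 : ∑ k ∈ s, w k * (w k * V k) = ∑ k ∈ s, w k ^ 2 * V k := Finset.sum_congr rfl fun k _ => by ring
    have e2 : ∑ k ∈ s, w k * (w k * V k) ^ 2 = ∑ k ∈ s, w k ^ 3 * V k ^ 2 := Finset.sum_congr rfl fun k _ => by ring
    rw [e1, e2] at this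
    exact this
  have hV2 : ∑ k ∈ s, w k ^ 3 * V k ^ 2 ≤ E ^ 2 / 4 * ∑ k ∈ s, w k ^ 3 * V k := by
    rw [Finset.mul_sum]
    refine Finset.sum_le_sum fun k hk => ?_
    have h3 : 0 ≤ w k ^ 3 := pow_nonneg (hw k hk) 3
    have := hVle k
    have := hV0 k
    nlinarith [mul_nonneg h3 (hV0 k)]
  have hO : ∑ k ∈ s, w k ^ 3 * V k ≤ (∑ k ∈ s, w k ^ 3 * (∑ j, q k j * I k j)) / 4 := by
    rw [Finset.sum_div]
    refine Finset.sum_le_sum fun k hk => ?_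
    have h3 : 0 ≤ w k ^ 3 := pow_nonneg (hw k hk) 3
    have := mul_le_mul_of_nonneg_left (hosss k) h3
    linarith
  change 16 * boolVariance p ^ 2 ≤ ∑ j, δb j * influence j p
  have hmain : E ^ 4 * (16 * boolVariance p ^ 2) ≤ E ^ 4 * ∑ j, δb j * influence j p := by
    calc E ^ 4 * (16 * boolVariance p ^ 2) = 16 * (E * (E * boolVariance p)) ^ 2 := by ring
      _ = 16 * (∑ k ∈ s, w k ^ 2 * V k) ^ 2 := by rw [hvar]
      _ ≤ 16 * ∑ k ∈ s, w k ^ 3 * V k ^ 2 := by linarith [hCS]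
      _ ≤ 16 * (E ^ 2 / 4 * ∑ k ∈ s, w k ^ 3 * V k) := by linarith [hV2]
      _ = 4 * E ^ 2 * ∑ k ∈ s, w k ^ 3 * V k := by ring
      _ ≤ 4 * E ^ 2 * ((∑ k ∈ s, w k ^ 3 * (∑ j, q k j * I k j)) / 4) := by
          have : 0 ≤ 4 * E ^ 2 := by positivity
          exact mul_le_mul_of_nonneg_left hO this
      _ = E ^ 2 * ∑ k ∈ s, w k ^ 3 * (∑ j, q k j * I k j) := by ring
      _ ≤ E ^ 2 * (E * (E * ∑ j, δb j * influence j p)) := by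
          have : 0 ≤ E ^ 2 := by positivity
          exact mul_le_mul_of_nonneg_left hRHS this
      _ = E ^ 4 * ∑ j, δb j * influence j p := by ring
  exact le_of_mul_le_mul_left hmain (by positivity)

end ClassicalCornerBlockProduct

end Summit.QuantumAdvantage.QuantumAdvantage.Theorems.SosSandwich

end
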